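import Summits.ValiantsHypothesis.ValiantsHypothesis.Theorems.KPlusLogSqLawStaticPathTrainDefs

/-!
# Route «KPlusLogSqLaw» — parametric maximum-weight independent set on a PATH: block optima (definitions)

HONEST FRAMING.  Definitions file (D-0009: reviewed/audited) for the divide-and-conquer layer (val-sym-lift-p4 g6
`HOME/val-sym-lift-p4/STATIC-PATH-NLOGN.md` §5–6) of the static-path tropical count, on top of the kernel fold lemma
`…Theorems.KPlusLogSqLaw.StaticPathFold` (seat val-sym-lift-p3 g6, 2026-08-27); a helper line toward the crux `WeakLifting` (item
`stmt-ValiantsHypothesis-19561`, route `KPlusLogSqLaw`) on its witness-plan stub `stub_tridiagonalSectorB`.  Items are indexed by `ℕ`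
with lines `W w₁ w₀ t θ = w₁ t * θ + w₀ t` (`KPlusLogSqLawStaticPathTrainDefs.lean`); this file names: independence of a set of items on
the path (`Indep`: no two consecutive items), the BLOCK OPTIMUM `opt i len θ` = the maximum total weight at `θ` of an independent subset
of the block of items `i+1, …, i+len` (empty set allowed), and the re-indexings `shift` / `rev` of the coefficient sequences under which a
block read from the left / from the right becomes the items `1, …, len` of the DP of `KPlusLogSqLawStaticPathTrainDefs.lean`.  No `Prop`
about the route is asserted; nothing here bears on `WeakLifting`, `TropicalB`, `KPlusLogSqLaw`, `MatrixDescartes` (stmt-ValiantsHypothesis-18050)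
or `VP ≠ VNP`.

[folklore] (maximum-weight independent sets on a path).
-/

set_option linter.dupNamespace false
set_option autoImplicit false

namespace Summit.ValiantsHypothesis.ValiantsHypothesis.Theorems.KPlusLogSqLaw

namespace StaticPathFold

open Finset Classical

noncomputable section

/-- independence on the path: no two consecutive items. [folklore] -/
def Indep (S : Finset ℕ) : Prop := ∀ t ∈ S, t + 1 ∉ S

/-- the independent subsets of the block of items `i+1, …, i+len`. [folklore] -/
def indepSets (i len : ℕ) : Finset (Finset ℕ) := (Finset.Ioc i (i + len)).powerset.filter Indep

/-- the empty set is an independent subset of every block. [folklore] -/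
theorem empty_mem_indepSets (i len : ℕ) : ∅ ∈ indepSets i len := by
  unfold indepSets
  simp only [mem_filter, mem_powerset, empty_subset, true_and]
  intro t ht; simp at ht

/-- the BLOCK OPTIMUM at parameter `θ`: the maximum total weight of an independent subset of the items `i+1, …, i+len`. [folklore] -/
def opt (w₁ w₀ : ℕ → ℝ) (i len : ℕ) (θ : ℝ) : ℝ :=
  (indepSets i len).sup' ⟨∅, empty_mem_indepSets i len⟩ fun S => ∑ t ∈ S, W w₁ w₀ t θ

/-- left re-indexing: item `t` of the DP is the global item `i + t`. [folklore] -/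
def shift (i : ℕ) (w : ℕ → ℝ) : ℕ → ℝ := fun t => w (i + t)

/-- right re-indexing of the block `i+1, …, i+len` read from the right: item `t` of the DP is the global item `i + len + 1 - t`. [folklore] -/
def rev (i len : ℕ) (w : ℕ → ℝ) : ℕ → ℝ := fun t => w (i + len + 1 - t)

end

end StaticPathFold

end Summit.ValiantsHypothesis.ValiantsHypothesis.Theorems.KPlusLogSqLaw
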